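import Mathlib
import Literature.Computability.AutomaticStructures.AutomaticBlock
import Literature.Computability.AutomaticStructures.DigitPathCount
import Literature.Combinatorics.Additive.TripleProductProperty
import Literature.Computability.AlgebraicComplexity.GroupTheoreticMatMulThmBProofs
import Summits.MatrixMultiplication.MatrixMultiplication.Theorems.AutomaticSTPPDesignsRegularTowerGapStubAbelianSubPacking

/-!
# MatrixMultiplication / AutomaticSTPPDesigns — `RegularTowerGap`, stub `stub_oneGoodScale`

Route `AutomaticSTPPDesigns`, crux `RegularTowerGap` (stmt-MatrixMultiplication-7358), line `Sketch`
(removal × Fekete): the STPP RE-ENTRY step. The digit-track path counts `N_X s s' k w` of the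
three DFAs (the entries of the products of their digit transfer matrices along the index word;
the tree's `pathCount`, `Literature/Computability/AutomaticStructures/DigitPathCount.lean`) enter
the stub through CHARACTERISING HYPOTHESES, so the registered signature mentions Mathlib's `DFA`
and the tree's `automaticBlock` / `AddSimultaneousTPP` only; the toolkit section transports the
`pathCount` API along `hN`.

`stub_oneGoodScale`: for three DFAs over `ι × Fin p` whose automatic family is STPP in `ℤ/(p^k)`
at every scale and a set `R` of state triples each jointly reachable from the start triple and
jointly co-reachable to an accepting triple (along a COMMON index word, one digit word per
automaton), the trimmed entry sum at the critical exponent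
`Z_{2/3}(k) = Σ_w Σ_{q,q' ∈ R} (N_A N_B N_C)^{2/3}` is `< p^{k₀}` at some scale `k₀ ≥ 1`.

Proof. Fix for every `q ∈ R` a reaching prefix `(u_q; αA, αB, αC)` of length `m_q` and for every
`q' ∈ R` an accepting suffix `(v_{q'}; βA, βB, βC)` of length `n_{q'}`. The digit words driving
`q` to `q'` along `w`, framed as `α a β` and read in `ℤ/(p^(m+k+n))`, form sub-blocks of the
genuine blocks at the index word `u_q w v_{q'}` (`pathBlock_subset_automaticBlock`) of cardinality
the path counts (`card_pathBlock`); sub-blocks of a reindexed STPP family are STPP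
(`AddSimultaneousTPP.comp`, `addSimultaneousTPP_mono`), so the removal bound
`stub_abelianSubPacking` gives `Σ_w (entry)^{2/3} ≤ η p^{m+k+n}` once `p^k ≥ N₀(η)`. Summing over
the pairs with `η = 1/(2(C+1))`, `C = Σ_{q,q'} p^{m_q+n_{q'}}`, `k₀ = N₀ + 1`:
`Z_{2/3}(k₀) ≤ η C p^{k₀} < p^{k₀}`.
-/

-- single-conjunct summit: the mandated namespace repeats `MatrixMultiplication`.
set_option linter.dupNamespace false

noncomputable section

open Finset

open scoped BigOperators Classical

namespace Summit.MatrixMultiplication.MatrixMultiplication.Theorems.RegularTowerGap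

open Literature.Combinatorics.Additive (AddSimultaneousTPP)
open Literature.Computability.AutomaticStructures

/-! ## Transfer-matrix toolkit, through characterising hypotheses

`N s s' k w` is the digit-track PATH COUNT of the DFA `M` (the number of digit words
`a : Fin k → Fin p` driving `s` to `s'` along the index word `w : Fin k → ι`), introduced through
its characterising equation `hN`; it is the tree's `pathCount M s s' k w`
(`Literature/Computability/AutomaticStructures/DigitPathCount.lean`), whose API is transported. -/

section Toolkit

variable {ι : Type*} {p : ℕ} {σ : Type*} (M : DFA (ι × Fin p) σ)
  (N : σ → σ → (k : ℕ) → (Fin k → ι) → ℕ)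
  (hN : ∀ (s s' : σ) (k : ℕ) (w : Fin k → ι), N s s' k w =
    ((Finset.univ : Finset (Fin k → Fin p)).filter
      (fun a => M.evalFrom s (List.ofFn fun j : Fin k => (w j, a j)) = s')).card)

include hN in
/-- The characterising equation says `N = pathCount M`. -/
theorem count_eq_pathCount (s s' : σ) (k : ℕ) (w : Fin k → ι) :
    N s s' k w = pathCount M s s' k w :=
  hN s s' k w

include hN in
/-- `N s s' k w ≠ 0` iff some digit word drives `s` to `s'` along `w`. -/
theorem count_ne_zero_iff {s s' : σ} {k : ℕ} {w : Fin k → ι} :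
    N s s' k w ≠ 0 ↔
      ∃ a : Fin k → Fin p, M.evalFrom s (List.ofFn fun j : Fin k => (w j, a j)) = s' := by
  rw [count_eq_pathCount M N hN]
  exact pathCount_ne_zero_iff M

include hN in
/-- The trivial bound `N s s' k w ≤ p^k`. -/
theorem count_le (s s' : σ) (k : ℕ) (w : Fin k → ι) : N s s' k w ≤ p ^ k := by
  rw [count_eq_pathCount M N hN]
  exact pathCount_le M s s' k w

include hN in
/-- At length `0` the path-count matrix is the identity. -/
theorem count_zero (s s' : σ) (w : Fin 0 → ι) : N s s' 0 w = if s = s' then 1 else 0 := by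
  rw [count_eq_pathCount M N hN]
  exact pathCount_zero M s s' w

include hN in
/-- **Multiplicativity** (the transfer-matrix product along `Fin.append u v`). -/
theorem count_append [Fintype σ] (s s'' : σ) {k l : ℕ} (u : Fin k → ι) (v : Fin l → ι) :
    N s s'' (k + l) (Fin.append u v) = ∑ s', N s s' k u * N s' s'' l v := by
  simp only [count_eq_pathCount M N hN]
  exact pathCount_append M s s'' u v

include hN in
/-- **`|A_w| = ∑_{s' accepting} N start s' k w`** for the block of the automatic family of
`M.accepts` at the index word `w`. -/
theorem card_automaticBlock_eq_sum_count [Fintype σ] (k : ℕ) (w : Fin k → ι) :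
    (automaticBlock p k M.accepts w).card =
      ∑ s' ∈ (Finset.univ : Finset σ).filter (fun s' => s' ∈ M.accept), N M.start s' k w := by
  simp only [count_eq_pathCount M N hN]
  exact card_automaticBlock_eq_sum_pathCount M k w

end Toolkit

/-- `w ↦ u w v` (framing an index word by a fixed prefix and suffix) is injective. -/
theorem append_append_injective {α : Type*} {m k n : ℕ} (u : Fin m → α) (v : Fin n → α) :
    Function.Injective fun w : Fin k → α => Fin.append (Fin.append u w) v := by
  intro a b h
  have h1 : Fin.append u a = Fin.append u b := by
    have := congrArg (fun c => ((Fin.appendEquiv (m + k) n).symm c).1) h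
    simpa only [Fin.appendEquiv, Equiv.coe_fn_symm_mk, Fin.append_left] using this
  have := congrArg (fun c => ((Fin.appendEquiv m k).symm c).2) h1
  simpa only [Fin.appendEquiv, Equiv.coe_fn_symm_mk, Fin.append_right] using this

/-! ## Shrinking STPP families -/

/-- Sub-blocks of an STPP family form an STPP family (both clauses of CKSU Def. 5.1 are universal
statements over the members of the blocks). -/
theorem addSimultaneousTPP_mono {H : Type*} [AddCommGroup H] {κ : Type*}
    {A B C A' B' C' : κ → Finset H} (h : AddSimultaneousTPP A B C) (hA : ∀ i, A' i ⊆ A i)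
    (hB : ∀ i, B' i ⊆ B i) (hC : ∀ i, C' i ⊆ C i) : AddSimultaneousTPP A' B' C' :=
  ⟨fun i => (h.1 i).mono (hA i) (hB i) (hC i),
    fun i j k a ha a' ha' b hb b' hb' c hc c' hc' he =>
      h.2 i j k a (hA i ha) a' (hA j ha') b (hB j hb) b' (hB k hb') c (hC k hc) c' (hC i hc') he⟩

/-! ## One good scale -/

/-- **One good scale** (stub, the line's load-bearing step): for three DFAs whose automatic family
is STPP at all scales and a set `R` of state triples each jointly reachable from the start triple
and jointly co-reachable to an accepting triple, the trimmed entry sum at the critical exponent is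
eventually below `p^k`; in particular `Z_{2/3}(k₀) < p^{k₀}` at some `k₀ ≥ 1`. (Each entry is the
size product of an STPP family of sub-blocks at scale `m + k + n`,
`pathBlock_subset_automaticBlock`, and `stub_abelianSubPacking` bounds those by `η p^{m+k+n}`,
`η` small against `|R|² p^{m+n}`.) The path counts `NA, NB, NC` enter through their
characterising equations. -/
theorem stub_oneGoodScale :
    ∀ (p : ℕ) (ι : Type) [Fintype ι] (σA σB σC : Type) [Fintype σA] [Fintype σB] [Fintype σC]
      (MA : DFA (ι × Fin p) σA) (MB : DFA (ι × Fin p) σB) (MC : DFA (ι × Fin p) σC)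
      (NA : σA → σA → (k : ℕ) → (Fin k → ι) → ℕ) (NB : σB → σB → (k : ℕ) → (Fin k → ι) → ℕ)
      (NC : σC → σC → (k : ℕ) → (Fin k → ι) → ℕ),
      (∀ (s s' : σA) (k : ℕ) (w : Fin k → ι), NA s s' k w =
        ((Finset.univ : Finset (Fin k → Fin p)).filter
          (fun a => MA.evalFrom s (List.ofFn fun j : Fin k => (w j, a j)) = s')).card) →
      (∀ (s s' : σB) (k : ℕ) (w : Fin k → ι), NB s s' k w =
        ((Finset.univ : Finset (Fin k → Fin p)).filter
          (fun a => MB.evalFrom s (List.ofFn fun j : Fin k => (w j, a j)) = s')).card) →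
      (∀ (s s' : σC) (k : ℕ) (w : Fin k → ι), NC s s' k w =
        ((Finset.univ : Finset (Fin k → Fin p)).filter
          (fun a => MC.evalFrom s (List.ofFn fun j : Fin k => (w j, a j)) = s')).card) →
      2 ≤ p →
      (∀ k : ℕ, AddSimultaneousTPP (automaticBlock p k MA.accepts) (automaticBlock p k MB.accepts)
        (automaticBlock p k MC.accepts)) →
      ∀ R : Finset (σA × σB × σC),
        (∀ q ∈ R,
          (∃ (m : ℕ) (u : Fin m → ι), NA MA.start q.1 m u * NB MB.start q.2.1 m u *
              NC MC.start q.2.2 m u ≠ 0) ∧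
          (∃ (n : ℕ) (v : Fin n → ι) (f : σA × σB × σC),
              (f.1 ∈ MA.accept ∧ f.2.1 ∈ MB.accept ∧ f.2.2 ∈ MC.accept) ∧
              NA q.1 f.1 n v * NB q.2.1 f.2.1 n v *
                NC q.2.2 f.2.2 n v ≠ 0)) →
        ∃ k₀ : ℕ, 1 ≤ k₀ ∧
          ∑ w : Fin k₀ → ι, ∑ q ∈ R, ∑ q' ∈ R,
            ((NA q.1 q'.1 k₀ w * NB q.2.1 q'.2.1 k₀ w *
                NC q.2.2 q'.2.2 k₀ w : ℕ) : ℝ) ^ ((2 : ℝ) / 3) < (p : ℝ) ^ k₀ := by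
  intro p ι _ σA σB σC _ _ _ MA MB MC NA NB NC hNA hNB hNC hp hS R hR
  have hp0 : 0 < p := by omega
  have hpR : (0 : ℝ) < p := by exact_mod_cast hp0
  -- reaching witnesses (common index prefix, one digit prefix per automaton)
  have hreach : ∀ q : R, ∃ (m : ℕ) (u : Fin m → ι) (αA : Fin m → Fin p) (αB : Fin m → Fin p)
      (αC : Fin m → Fin p),
      MA.evalFrom MA.start (List.ofFn fun j : Fin m => (u j, αA j)) = q.1.1 ∧
      MB.evalFrom MB.start (List.ofFn fun j : Fin m => (u j, αB j)) = q.1.2.1 ∧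
      MC.evalFrom MC.start (List.ofFn fun j : Fin m => (u j, αC j)) = q.1.2.2 := by
    intro q
    obtain ⟨⟨m, u, hne⟩, -⟩ := hR q.1 q.2
    obtain ⟨hAB, hC⟩ := mul_ne_zero_iff.1 hne
    obtain ⟨hA, hB⟩ := mul_ne_zero_iff.1 hAB
    obtain ⟨αA, hαA⟩ := (count_ne_zero_iff MA NA hNA).1 hA
    obtain ⟨αB, hαB⟩ := (count_ne_zero_iff MB NB hNB).1 hB
    obtain ⟨αC, hαC⟩ := (count_ne_zero_iff MC NC hNC).1 hC
    exact ⟨m, u, αA, αB, αC, hαA, hαB, hαC⟩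
  choose m u αA αB αC hαA hαB hαC using hreach
  -- accepting witnesses (common index suffix, one digit suffix per automaton)
  have hco : ∀ q : R, ∃ (n : ℕ) (v : Fin n → ι) (βA : Fin n → Fin p) (βB : Fin n → Fin p)
      (βC : Fin n → Fin p),
      MA.evalFrom q.1.1 (List.ofFn fun j : Fin n => (v j, βA j)) ∈ MA.accept ∧
      MB.evalFrom q.1.2.1 (List.ofFn fun j : Fin n => (v j, βB j)) ∈ MB.accept ∧
      MC.evalFrom q.1.2.2 (List.ofFn fun j : Fin n => (v j, βC j)) ∈ MC.accept := by
    intro q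
    obtain ⟨-, ⟨n, v, f, ⟨hfA, hfB, hfC⟩, hne⟩⟩ := hR q.1 q.2
    obtain ⟨hAB, hC⟩ := mul_ne_zero_iff.1 hne
    obtain ⟨hA, hB⟩ := mul_ne_zero_iff.1 hAB
    obtain ⟨βA, hβA⟩ := (count_ne_zero_iff MA NA hNA).1 hA
    obtain ⟨βB, hβB⟩ := (count_ne_zero_iff MB NB hNB).1 hB
    obtain ⟨βC, hβC⟩ := (count_ne_zero_iff MC NC hNC).1 hC
    exact ⟨n, v, βA, βB, βC, hβA.symm ▸ hfA, hβB.symm ▸ hfB, hβC.symm ▸ hfC⟩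
  choose n v βA βB βC hβA hβB hβC using hco
  -- constants: `Cst = Σ_{q,q'} p^{m_q + n_{q'}}`, `η Cst < 1`, `N₀` from removal, `k₀ = N₀ + 1`
  set Cst : ℝ := ∑ q : R, ∑ q' : R, (p : ℝ) ^ (m q + n q') with hCst
  have hCst0 : 0 ≤ Cst :=
    Finset.sum_nonneg fun _ _ => Finset.sum_nonneg fun _ _ => pow_nonneg hpR.le _
  set η : ℝ := 1 / (2 * (Cst + 1)) with hη
  have hη0 : 0 < η := by positivity
  have hηC : η * Cst < 1 := by
    rw [hη, one_div, inv_mul_eq_div, div_lt_one (by positivity)]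
    linarith
  obtain ⟨N₀, hN₀⟩ := stub_abelianSubPacking η hη0
  refine ⟨N₀ + 1, Nat.succ_pos _, ?_⟩
  have hpk : N₀ ≤ p ^ (N₀ + 1) :=
    (Nat.lt_two_pow_self).le.trans
      ((Nat.pow_le_pow_left hp N₀).trans (Nat.pow_le_pow_right hp0 (Nat.le_succ _)))
  -- the key estimate for one pair of trimmed states: an STPP family of sub-blocks
  have key : ∀ q q' : R,
      ∑ w : Fin (N₀ + 1) → ι,
        ((NA q.1.1 q'.1.1 (N₀ + 1) w * NB q.1.2.1 q'.1.2.1 (N₀ + 1) w *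
            NC q.1.2.2 q'.1.2.2 (N₀ + 1) w : ℕ) : ℝ) ^ ((2 : ℝ) / 3) ≤
        η * (p : ℝ) ^ (m q + (N₀ + 1) + n q') := by
    intro q q'
    haveI : NeZero (p ^ (m q + (N₀ + 1) + n q')) := ⟨pow_ne_zero _ hp0.ne'⟩
    have hsub : AddSimultaneousTPP
        (fun w : Fin (N₀ + 1) → ι => pathBlock MA q.1.1 q'.1.1 (αA q) w (βA q'))
        (fun w : Fin (N₀ + 1) → ι => pathBlock MB q.1.2.1 q'.1.2.1 (αB q) w (βB q'))
        (fun w : Fin (N₀ + 1) → ι => pathBlock MC q.1.2.2 q'.1.2.2 (αC q) w (βC q')) := by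
      have h1 := (hS (m q + (N₀ + 1) + n q')).comp (append_append_injective (u q) (v q'))
      exact addSimultaneousTPP_mono h1
        (fun w => pathBlock_subset_automaticBlock MA _ _ (hαA q) w (hβA q'))
        (fun w => pathBlock_subset_automaticBlock MB _ _ (hαB q) w (hβB q'))
        (fun w => pathBlock_subset_automaticBlock MC _ _ (hαC q) w (hβC q'))
    have hcard : N₀ ≤ Fintype.card (ZMod (p ^ (m q + (N₀ + 1) + n q'))) := by
      rw [ZMod.card]
      exact hpk.trans (Nat.pow_le_pow_right hp0 (by omega))
    have h := hN₀ (ZMod (p ^ (m q + (N₀ + 1) + n q'))) hcard (Fin (N₀ + 1) → ι) _ _ _ hsub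
    rw [ZMod.card, Nat.cast_pow] at h
    simp only [card_pathBlock] at h
    simpa only [count_eq_pathCount MA NA hNA, count_eq_pathCount MB NB hNB,
      count_eq_pathCount MC NC hNC] using h
  -- summing the key estimate over the pairs
  have hswap : ∑ w : Fin (N₀ + 1) → ι, ∑ q ∈ R, ∑ q' ∈ R,
      ((NA q.1 q'.1 (N₀ + 1) w * NB q.2.1 q'.2.1 (N₀ + 1) w *
          NC q.2.2 q'.2.2 (N₀ + 1) w : ℕ) : ℝ) ^ ((2 : ℝ) / 3) =
      ∑ q : R, ∑ q' : R, ∑ w : Fin (N₀ + 1) → ι,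
        ((NA q.1.1 q'.1.1 (N₀ + 1) w * NB q.1.2.1 q'.1.2.1 (N₀ + 1) w *
            NC q.1.2.2 q'.1.2.2 (N₀ + 1) w : ℕ) : ℝ) ^ ((2 : ℝ) / 3) := by
    rw [Finset.sum_comm, ← Finset.sum_coe_sort R]
    refine Finset.sum_congr rfl fun q _ => ?_
    rw [Finset.sum_comm, ← Finset.sum_coe_sort R]
  rw [hswap]
  calc ∑ q : R, ∑ q' : R, ∑ w : Fin (N₀ + 1) → ι,
        ((NA q.1.1 q'.1.1 (N₀ + 1) w * NB q.1.2.1 q'.1.2.1 (N₀ + 1) w *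
            NC q.1.2.2 q'.1.2.2 (N₀ + 1) w : ℕ) : ℝ) ^ ((2 : ℝ) / 3)
      ≤ ∑ q : R, ∑ q' : R, η * (p : ℝ) ^ (m q + (N₀ + 1) + n q') :=
        Finset.sum_le_sum fun q _ => Finset.sum_le_sum fun q' _ => key q q'
    _ = η * (p : ℝ) ^ (N₀ + 1) * Cst := by
        rw [hCst, Finset.mul_sum]
        refine Finset.sum_congr rfl fun q _ => ?_
        rw [Finset.mul_sum]
        refine Finset.sum_congr rfl fun q' _ => ?_
        rw [pow_add, pow_add, pow_add]
        ring
    _ < (p : ℝ) ^ (N₀ + 1) := by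
        have hpow : (0 : ℝ) < (p : ℝ) ^ (N₀ + 1) := pow_pos hpR _
        calc η * (p : ℝ) ^ (N₀ + 1) * Cst = (η * Cst) * (p : ℝ) ^ (N₀ + 1) := by ring
          _ < 1 * (p : ℝ) ^ (N₀ + 1) := mul_lt_mul_of_pos_right hηC hpow
          _ = (p : ℝ) ^ (N₀ + 1) := one_mul _

end Summit.MatrixMultiplication.MatrixMultiplication.Theorems.RegularTowerGap
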